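import Summits.CriticalPhenomena.PercolationContinuityZ3.Theorems.PercNearOneGluingNoHeavyLowerTailSahiPivotDichotomy
import Mathlib
import HarnessLib
import HarnessLib.Audit.Tags

/-!
# `NoHeavyLowerTail` (crux stmt-CriticalPhenomena-4575), master-family line P1 (gen 17):
# EXCHANGEABLE COORDINATE WEIGHTS — the typed conjecture LC-EXMAX and its kernel link to `PivotDichotomy`

Support file (seat `prim-masterthm-p1`, gen 17; `--supports stmt-CriticalPhenomena-4575`), on top of the tree's
`SahiPivotDichotomy` (gen 16: `sideSum`, `rainbowSum`, typed `PivotDichotomy`).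
Memo `run/shared/lean/prim/prim-masterthm/FROM-prim-masterthm-p1-g17-TRIPARTITION-ULC.md` §5 and gen 16's memo
`FROM-prim-masterthm-p1-g16-ONE-PAYER.md` §9.

SETTING.  A sunflower labeling `f : 2^S → {B < C₁,…,C_k < A}` and, for every coordinate `j ∈ S`, a weight vector
`w j : ℕ → ℝ` read at `c ∈ {0,1,2,3}`; a triple `(x,y,z)` of subsets of `S` gets the weight
`Π_{j ∈ S} w j (#{x,y,z ∋ j})` (COORDINATEWISE-INDEPENDENT, EXCHANGEABLE in the three positions).  The weighted sums
`wSideSum … A = Σ 3·[f x = A]·κ(f y, f z)·weight` (core side `Φ_A`), `wSideSum … B` (outside side `Φ_B`) and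
`wRainbowSum = Σ [f x, f y, f z rainbow]·weight` (`T`) specialise: at the PURE weight `w j = δ₁` to gen 16's fibre sums
`sideSum S f A`, `sideSum S f B`, `rainbowSum S f` (`wSideSum_pure`, `wRainbowSum_pure`, this file), at i.i.d. weights
`(q³,q²p,qp²,p³)` to the measure aggregates `6κG, 6oG, 6e₃` of a product measure (memo g16 §0), and at block
statistics `(d,a,b,g)_i` to the fibre sums of a block composite (block calculus, memo g16 §3).
* **CONJECTURE LC-EXMAX (typed `LCExmax k`; gen 16 §9, census there and memo g17 §5):** for LOG-CONCAVE weights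
  (`w j 0 · w j 2 ≤ (w j 1)²`, `w j 1 · w j 3 ≤ (w j 2)²`, nonnegative) `T ≤ max(Φ_A, Φ_B)`.  With ARBITRARY nonnegative
  weights this is FALSE (m = 5, memo g16 §9); log-concavity is exactly what i.i.d. weights satisfy with equality and
  what block statistics of unate blocks satisfy conjecturally (`SahiTripartition.UnateTripartitionULC`).
* THEOREM (kernel link, this file): `LCExmax k → PivotDichotomy k` (pure weights are log-concave and turn the weighted
  sums into the fibre sums).
* **CONJECTURE (typed `ExchangeableLCClosed`; new, memo g17 §5): log-concave weights are CLOSED UNDER MONOTONE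
  SUBSTITUTION** — for a monotone Boolean `u` and log-concave weights the induced pattern weights
  `N_c = Σ weight·[#{u x, u y, u z} = c]` satisfy `3N₀N₂ ≤ N₁²`, `3N₁N₃ ≤ N₂²`; at pure/twisted vertex weights this is
  `UnateTripartitionULC`, and it is what makes LC-EXMAX composition-closed (LC-EXMAX for the base system at the induced
  weights = LC-EXMAX for the composite).  Census (exact, random log-concave integer weights): 11 400 (u,w) on 3 points,
  8 350 on 4 points, 0 failures; with free nonnegative weights 18 % failures.
HONEST FRAMING: typed conjectures + one proved link; LC-EXMAX, `PivotDichotomy`, CP3⁺, S₃^max remain OPEN. [this work]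
-/

namespace Summit.CriticalPhenomena.PercolationContinuityZ3.Theorems

namespace SahiPivotFamily

open Finset AntipodalStrongHarris AntipodalStrongHarris.Lab

variable {k : ℕ}

variable {α : Type*} [DecidableEq α]

/-! ### 1. Exchangeable coordinate weights and the weighted sums -/

/-- The weight of a triple `(x,y,z)`: `Π_{j ∈ S} w j (#{x,y,z ∋ j})`. [this work] -/
def tripleWeight (S : Finset α) (w : α → ℕ → ℝ) (x y z : Finset α) : ℝ :=
  ∏ j ∈ S, w j ((if j ∈ x then 1 else 0) + (if j ∈ y then 1 else 0) + (if j ∈ z then 1 else 0))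

/-- Weighted side sum `Σ_{x,y,z ⊆ S} [f x = a]·3κ(f y, f z)·weight` (`a = A`: `Φ_A`; `a = B`: `Φ_B`). [this work] -/
def wSideSum (S : Finset α) (w : α → ℕ → ℝ) (f : Finset α → Lab k) (a : Lab k) : ℝ :=
  ∑ x ∈ S.powerset, ∑ y ∈ S.powerset, ∑ z ∈ S.powerset,
    if f x = a then tripleWeight S w x y z * (3 * (kappa (f y) (f z) : ℝ)) else 0

/-- Weighted rainbow sum `T = Σ_{x,y,z ⊆ S} [f x, f y, f z pairwise different petals]·weight`. [this work] -/
def wRainbowSum (S : Finset α) (w : α → ℕ → ℝ) (f : Finset α → Lab k) : ℝ :=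
  ∑ x ∈ S.powerset, ∑ y ∈ S.powerset, ∑ z ∈ S.powerset,
    tripleWeight S w x y z * (rainbow (f x) (f y) (f z) : ℝ)

/-- A log-concave (and nonnegative) coordinate weight: `w₀w₂ ≤ w₁²`, `w₁w₃ ≤ w₂²`. [this work] -/
def LogConcaveWt (v : ℕ → ℝ) : Prop := (∀ c, 0 ≤ v c) ∧ v 0 * v 2 ≤ v 1 ^ 2 ∧ v 1 * v 3 ≤ v 2 ^ 2

/-- The pure ("fibre vertex") weight `δ₁`: each coordinate lies in exactly one of the three sets. [this work] -/
def pureWt : ℕ → ℝ := fun c => if c = 1 then 1 else 0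

/-- The pure weight is log-concave. [this work] -/
theorem logConcaveWt_pure : LogConcaveWt pureWt := by
  refine ⟨fun c => ?_, ?_, ?_⟩
  · simp only [pureWt]; split_ifs <;> norm_num
  · simp [pureWt]
  · simp [pureWt]

/-! ### 2. At the pure weight the weighted sums are the fibre sums -/

/-- Per-coordinate count `#{x,y,z ∋ j} = 1` for all `j ∈ S` iff `(x, y, z)` is an ordered tripartition of `S`
(for `x, z ⊆ S`). [this work] -/
theorem forall_count_eq_one_iff {S x y z : Finset α} (hx : x ⊆ S) (hz : z ⊆ S) :
    (∀ j ∈ S, (if j ∈ x then 1 else 0) + (if j ∈ y then 1 else 0) + (if j ∈ z then 1 else 0) = (1 : ℕ)) ↔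
      (Disjoint x y ∧ z = S \ (x ∪ y)) := by
  constructor
  · intro h
    refine ⟨disjoint_left.mpr fun j hjx hjy => ?_, ?_⟩
    · have := h j (hx hjx)
      simp only [hjx, hjy, if_true] at this
      split_ifs at this <;> omega
    · ext j
      simp only [mem_sdiff, mem_union, not_or]
      constructor
      · intro hjz
        have := h j (hz hjz)
        by_cases hjx : j ∈ x <;> by_cases hjy : j ∈ y <;> simp [hjx, hjy, hjz] at this ⊢
        exact hz hjz
      · rintro ⟨hjS, hjx, hjy⟩
        have := h j hjS
        by_cases hjz : j ∈ z
        · exact hjz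
        · simp [hjx, hjy, hjz] at this
  · rintro ⟨hd, rfl⟩ j hjS
    by_cases hjx : j ∈ x
    · have hjy : j ∉ y := disjoint_left.mp hd hjx
      simp [hjx, hjy]
    · by_cases hjy : j ∈ y
      · simp [hjx, hjy]
      · simp [hjx, hjy, hjS]

/-- At the pure weight the triple weight is the indicator of ordered tripartitions of `S`. [this work] -/
theorem tripleWeight_pure {S x y z : Finset α} (hx : x ⊆ S) (hz : z ⊆ S) :
    tripleWeight S (fun _ => pureWt) x y z = if Disjoint x y ∧ z = S \ (x ∪ y) then 1 else 0 := by
  unfold tripleWeight pureWt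
  rw [prod_boole]
  by_cases h : Disjoint x y ∧ z = S \ (x ∪ y)
  · rw [if_pos h, if_pos ((forall_count_eq_one_iff hx hz).mpr h)]
  · rw [if_neg h, if_neg (fun h' => h ((forall_count_eq_one_iff hx hz).mp h'))]

/-- Collapsing a triple sum against the tripartition indicator into the fibre double sum. [this work] -/
theorem sum_tripartition_indicator (S : Finset α) (g : Finset α → Finset α → Finset α → ℝ) :
    (∑ x ∈ S.powerset, ∑ y ∈ S.powerset, ∑ z ∈ S.powerset,
        (if Disjoint x y ∧ z = S \ (x ∪ y) then 1 else 0) * g x y z) =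
      ∑ x ∈ S.powerset, ∑ y ∈ (S \ x).powerset, g x y ((S \ x) \ y) := by
  refine sum_congr rfl fun x hx => ?_
  have hxS : x ⊆ S := mem_powerset.mp hx
  -- the `z`-sum picks `z = S \ (x ∪ y)`
  have hz : ∀ y ∈ S.powerset, (∑ z ∈ S.powerset, (if Disjoint x y ∧ z = S \ (x ∪ y) then 1 else 0) * g x y z)
      = if Disjoint x y then g x y (S \ (x ∪ y)) else 0 := by
    intro y _
    by_cases hd : Disjoint x y
    · simp only [hd, true_and, if_true, boole_mul]
      rw [sum_ite_eq', if_pos (mem_powerset.mpr sdiff_subset)]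
    · simp [hd]
  rw [sum_congr rfl hz, ← sum_filter]
  have hfil : S.powerset.filter (fun y => Disjoint x y) = (S \ x).powerset := by
    ext y
    simp only [mem_filter, mem_powerset, subset_sdiff, disjoint_comm]
  rw [hfil]
  refine sum_congr rfl fun y _ => ?_
  rw [sdiff_sdiff_left, sup_eq_union]

/-- **At the pure weight, `Φ_a` is gen 16's fibre side sum** `sideSum S f a`. [this work] -/
theorem wSideSum_pure (S : Finset α) (f : Finset α → Lab k) (a : Lab k) :
    wSideSum S (fun _ => pureWt) f a = (sideSum S f a : ℝ) := by
  unfold wSideSum sideSum antipodalSum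
  have step : (∑ x ∈ S.powerset, ∑ y ∈ S.powerset, ∑ z ∈ S.powerset,
      if f x = a then tripleWeight S (fun _ => pureWt) x y z * (3 * (kappa (f y) (f z) : ℝ)) else 0)
      = ∑ x ∈ S.powerset, ∑ y ∈ S.powerset, ∑ z ∈ S.powerset,
          (if Disjoint x y ∧ z = S \ (x ∪ y) then 1 else 0) *
            (if f x = a then 3 * (kappa (f y) (f z) : ℝ) else 0) := by
    refine sum_congr rfl fun x hx => sum_congr rfl fun y _ => sum_congr rfl fun z hz => ?_
    rw [tripleWeight_pure (mem_powerset.mp hx) (mem_powerset.mp hz)]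
    split_ifs <;> ring
  rw [step, sum_tripartition_indicator, Int.cast_sum, sum_filter]
  refine sum_congr rfl fun x _ => ?_
  split_ifs with h
  · push_cast
    rw [mul_sum]
  · simp

/-- **At the pure weight, `T` is gen 16's fibre rainbow count** `rainbowSum S f`. [this work] -/
theorem wRainbowSum_pure (S : Finset α) (f : Finset α → Lab k) :
    wRainbowSum S (fun _ => pureWt) f = (rainbowSum S f : ℝ) := by
  unfold wRainbowSum rainbowSum
  have step : (∑ x ∈ S.powerset, ∑ y ∈ S.powerset, ∑ z ∈ S.powerset,
      tripleWeight S (fun _ => pureWt) x y z * (rainbow (f x) (f y) (f z) : ℝ))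
      = ∑ x ∈ S.powerset, ∑ y ∈ S.powerset, ∑ z ∈ S.powerset,
          (if Disjoint x y ∧ z = S \ (x ∪ y) then 1 else 0) * (rainbow (f x) (f y) (f z) : ℝ) := by
    refine sum_congr rfl fun x hx => sum_congr rfl fun y _ => sum_congr rfl fun z hz => ?_
    rw [tripleWeight_pure (mem_powerset.mp hx) (mem_powerset.mp hz)]
  rw [step, sum_tripartition_indicator]
  push_cast
  rfl

/-! ### 3. The typed conjecture LC-EXMAX and the kernel link -/

/-- **CONJECTURE LC-EXMAX (typed; gen 16 §9).**  For every `k`, every finite `S ⊆ ℕ`, every sunflower labeling `f`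
of its subsets and all coordinatewise-independent exchangeable LOG-CONCAVE nonnegative weights:
`T ≤ Φ_A` or `T ≤ Φ_B` — one payer suffices at every admissible weighting.  At pure weights this is `PivotDichotomy`
(`pivotDichotomy_of_lcExmax`); at i.i.d. weights it is the one-payer conjecture S₃^max (memo g16 §0(ii)); FALSE for
arbitrary nonnegative weights (m = 5, memo g16 §9); census with log-concave weights: 0 failures (memo g16 §9).
[this work] [status: open] -/
@[conjecture] def LCExmax (k : ℕ) : Prop :=
  ∀ (S : Finset ℕ) (f : Finset ℕ → Lab k) (w : ℕ → ℕ → ℝ), (∀ ⦃X Y : Finset ℕ⦄, X ⊆ Y → f X ≤ f Y) →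
    (∀ j ∈ S, LogConcaveWt (w j)) →
      wRainbowSum S w f ≤ wSideSum S w f top ∨ wRainbowSum S w f ≤ wSideSum S w f bot

/-- **Kernel link: LC-EXMAX implies the one-payer dichotomy on every pure fibre** (hence CP3⁺ at pure patterns, via
the tree's `purePatternCP3Plus_of_pivotDichotomy`). [this work] -/
theorem pivotDichotomy_of_lcExmax (h : LCExmax k) : PivotDichotomy k := by
  intro S f hf
  have := h S f (fun _ => pureWt) hf (fun _ _ => logConcaveWt_pure)
  rw [wRainbowSum_pure, wSideSum_pure, wSideSum_pure] at this
  rcases this with h1 | h1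
  · exact Or.inl (by exact_mod_cast h1)
  · exact Or.inr (by exact_mod_cast h1)

/-- LC-EXMAX implies CP3⁺ at pure patterns. [this work] -/
theorem purePatternCP3Plus_of_lcExmax (h : LCExmax k) : PurePatternCP3Plus k :=
  purePatternCP3Plus_of_pivotDichotomy (pivotDichotomy_of_lcExmax h)

/-! ### 4. Closure of log-concave weights under monotone substitution (typed) -/

/-- The induced pattern weights of a Boolean function `u` on the subsets of `S` at weights `w`:
`N_c = Σ_{x,y,z ⊆ S} weight·[#{u x, u y, u z} = c]` — the block statistics `(d, 3a, 3b, g)` of the block `u` when `u`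
is a block of a composite system (memo g16 §3, at general weights). [this work] -/
def inducedWt (S : Finset α) (w : α → ℕ → ℝ) (u : Finset α → Bool) (c : ℕ) : ℝ :=
  ∑ x ∈ S.powerset, ∑ y ∈ S.powerset, ∑ z ∈ S.powerset,
    if (u x).toNat + (u y).toNat + (u z).toNat = c then tripleWeight S w x y z else 0

/-- **CONJECTURE (typed; new): log-concave exchangeable weights are closed under monotone substitution.**  For a
monotone Boolean `u` and log-concave weights the induced pattern weights satisfy `3N₀N₂ ≤ N₁²` and `3N₁N₃ ≤ N₂²`
(i.e. `(N₀, N₁/3, N₂/3, N₃)` is again a log-concave weight).  Equivalent to: under the weighted law conditioned on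
`u z` (either value), `u x` and `u y` are negatively correlated.  At pure / twisted vertex weights this is
`SahiTripartition.UnateTripartitionULC`; with i.i.d. weights equality holds; with free nonnegative weights it is
FALSE (18 % of random instances on 3–4 points); census with random log-concave integer weights: 19 750 pairs
`(u, w)` on 3 and 4 points, 0 failures (memo g17 §5).  Consequence: LC-EXMAX for a base system at the induced
weights is LC-EXMAX for the composite, so LC-EXMAX reduces to indecomposable systems. [this work] [status: open] -/
@[conjecture] def ExchangeableLCClosed : Prop :=
  ∀ (S : Finset ℕ) (u : Finset ℕ → Bool) (w : ℕ → ℕ → ℝ), Monotone u → (∀ j ∈ S, LogConcaveWt (w j)) →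
    3 * inducedWt S w u 0 * inducedWt S w u 2 ≤ inducedWt S w u 1 ^ 2 ∧
      3 * inducedWt S w u 1 * inducedWt S w u 3 ≤ inducedWt S w u 2 ^ 2

/-! ### 5. Correction (same session): log-concave weights must have NO INTERNAL ZEROS

`LogConcaveWt` above (`w₀w₂ ≤ w₁²`, `w₁w₃ ≤ w₂²`) admits the degenerate weight `(1,0,0,1)` — a coordinate on which the three
sets AGREE (`x_j = y_j = z_j`), i.e. a mixture of two sections.  With it `ExchangeableLCClosed` is FALSE
(`not_exchangeableLCClosed`: ground set `{0,1}`, `u = [0 ∈ x] ∨ [1 ∈ x]`, coordinate `0` degenerate, coordinate `1` pure,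
induced weights `(N₀,N₁,N₂,N₃) = (0,3,0,3)`).  The intended class (the one used in every census of the memos, whose
generators always had `w₁ > 0` or `w₂ > 0`) is log-concave WITHOUT internal zeros, which for length 4 is the extra
condition `w₀w₃ ≤ w₁w₂` (`LogConcaveWtNIZ`); the intended conjectures are `LCExmaxNIZ` and `ExchangeableLCClosedNIZ`
below.  `LCExmax` (the statement over the larger class) implies `LCExmaxNIZ` and is not known to be false; the pure weight
is in the smaller class, so the kernel link to `PivotDichotomy` is unchanged (`pivotDichotomy_of_lcExmaxNIZ`). [this work] -/

/-- Log-concave weight WITHOUT internal zeros: additionally `w₀w₃ ≤ w₁w₂` (excludes `(1,0,0,1)`). [this work] -/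
def LogConcaveWtNIZ (v : ℕ → ℝ) : Prop := LogConcaveWt v ∧ v 0 * v 3 ≤ v 1 * v 2

/-- The pure weight has no internal zeros. [this work] -/
theorem logConcaveWtNIZ_pure : LogConcaveWtNIZ pureWt :=
  ⟨logConcaveWt_pure, by simp [pureWt]⟩

/-- **CONJECTURE LC-EXMAX (intended form; typed).**  As `LCExmax`, for log-concave weights without internal zeros.
Census (memo g16 §9, memo g17 §5): 0 failures. [this work] [status: open] -/
@[conjecture] def LCExmaxNIZ (k : ℕ) : Prop :=
  ∀ (S : Finset ℕ) (f : Finset ℕ → Lab k) (w : ℕ → ℕ → ℝ), (∀ ⦃X Y : Finset ℕ⦄, X ⊆ Y → f X ≤ f Y) →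
    (∀ j ∈ S, LogConcaveWtNIZ (w j)) →
      wRainbowSum S w f ≤ wSideSum S w f top ∨ wRainbowSum S w f ≤ wSideSum S w f bot

/-- The statement over the larger weight class implies the intended one. [this work] -/
theorem lcExmaxNIZ_of_lcExmax (h : LCExmax k) : LCExmaxNIZ k :=
  fun S f w hf hw => h S f w hf fun j hj => (hw j hj).1

/-- **Kernel link (intended form): LC-EXMAX without internal zeros implies the one-payer dichotomy on every pure fibre.**
[this work] -/
theorem pivotDichotomy_of_lcExmaxNIZ (h : LCExmaxNIZ k) : PivotDichotomy k := by
  intro S f hf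
  have := h S f (fun _ => pureWt) hf (fun _ _ => logConcaveWtNIZ_pure)
  rw [wRainbowSum_pure, wSideSum_pure, wSideSum_pure] at this
  rcases this with h1 | h1
  · exact Or.inl (by exact_mod_cast h1)
  · exact Or.inr (by exact_mod_cast h1)

/-- **CONJECTURE (intended form; typed): log-concave weights without internal zeros are closed under monotone
substitution.**  Census (memo g17 §5; all generators had no internal zeros): 19 750 pairs, 0 failures; proved when all
coordinates but one carry i.i.d. weights (memo g17 §5: `F = d²(b²c₁ + bd c₂ + d²c₃)` with `c₁,c₂,c₃ ≤ 0` exactly the three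
length-4 log-concavity conditions). [this work] [status: open] -/
@[conjecture] def ExchangeableLCClosedNIZ : Prop :=
  ∀ (S : Finset ℕ) (u : Finset ℕ → Bool) (w : ℕ → ℕ → ℝ), Monotone u → (∀ j ∈ S, LogConcaveWtNIZ (w j)) →
    3 * inducedWt S w u 0 * inducedWt S w u 2 ≤ inducedWt S w u 1 ^ 2 ∧
      3 * inducedWt S w u 1 * inducedWt S w u 3 ≤ inducedWt S w u 2 ^ 2

/-- The degenerate weight system of the counterexample: coordinate `0` carries `(1,0,0,1)`, every other coordinate the
pure weight. [this work] -/
def degenWt : ℕ → ℕ → ℝ := fun j c => if j = 0 then (if c = 0 ∨ c = 3 then 1 else 0) else pureWt c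

/-- The degenerate weight satisfies the (too weak) `LogConcaveWt` at every coordinate. [this work] -/
theorem logConcaveWt_degen (j : ℕ) : LogConcaveWt (degenWt j) := by
  unfold degenWt LogConcaveWt pureWt
  by_cases hj : j = 0
  · subst hj
    refine ⟨fun c => ?_, ?_, ?_⟩
    · simp only [if_true]; split_ifs <;> norm_num
    · norm_num
    · norm_num
  · simp only [hj, if_false]
    refine ⟨fun c => ?_, ?_, ?_⟩
    · split_ifs <;> norm_num
    · norm_num
    · norm_num

/-- The test function of the counterexample: `u x = [0 ∈ x] ∨ [1 ∈ x]` (monotone). [this work] -/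
def orTwo : Finset ℕ → Bool := fun x => decide (0 ∈ x ∨ 1 ∈ x)

/-- `orTwo` is monotone. [this work] -/
theorem monotone_orTwo : Monotone orTwo := by
  intro x y hxy
  unfold orTwo
  rcases hb : decide (0 ∈ x ∨ 1 ∈ x) with _ | _
  · exact Bool.false_le _
  · have hx : 0 ∈ x ∨ 1 ∈ x := of_decide_eq_true hb
    have hy : 0 ∈ y ∨ 1 ∈ y := hx.imp (fun h => hxy h) (fun h => hxy h)
    rw [decide_eq_true hy]

/-- Sums over the powerset of `{0,1}`, unrolled. [this work] -/
private theorem sum_powerset_pair (g : Finset ℕ → ℝ) :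
    ∑ x ∈ ({0, 1} : Finset ℕ).powerset, g x = g ∅ + g {0} + g {1} + g {0, 1} := by
  have hp : ({0, 1} : Finset ℕ).powerset = {∅, {0}, {1}, {0, 1}} := by decide
  have h1 : (∅ : Finset ℕ) ∉ ({{0}, {1}, {0, 1}} : Finset (Finset ℕ)) := by decide
  have h2 : ({0} : Finset ℕ) ∉ ({{1}, {0, 1}} : Finset (Finset ℕ)) := by decide
  have h3 : ({1} : Finset ℕ) ≠ ({0, 1} : Finset ℕ) := by decide
  rw [hp, Finset.sum_insert h1, Finset.sum_insert h2, Finset.sum_pair h3]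
  ring

/-- Induced weights of the counterexample: `N₁ = 3`. [this work] -/
theorem inducedWt_degen_one : inducedWt {0, 1} degenWt orTwo 1 = 3 := by
  unfold inducedWt tripleWeight
  simp only [sum_powerset_pair]
  norm_num [degenWt, orTwo, pureWt, Finset.prod_insert, Finset.prod_singleton]

/-- Induced weights of the counterexample: `N₂ = 0`. [this work] -/
theorem inducedWt_degen_two : inducedWt {0, 1} degenWt orTwo 2 = 0 := by
  unfold inducedWt tripleWeight
  simp only [sum_powerset_pair]
  norm_num [degenWt, orTwo, pureWt, Finset.prod_insert, Finset.prod_singleton]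

/-- Induced weights of the counterexample: `N₃ = 3`. [this work] -/
theorem inducedWt_degen_three : inducedWt {0, 1} degenWt orTwo 3 = 3 := by
  unfold inducedWt tripleWeight
  simp only [sum_powerset_pair]
  norm_num [degenWt, orTwo, pureWt, Finset.prod_insert, Finset.prod_singleton]

/-- **REFUTATION of the too-weak form**: with internal zeros allowed, closure under monotone substitution fails
(`3·N₁·N₃ = 27 > 0 = N₂²`). [this work] -/
theorem not_exchangeableLCClosed : ¬ ExchangeableLCClosed := by
  intro h
  have := (h {0, 1} orTwo degenWt monotone_orTwo (fun j _ => logConcaveWt_degen j)).2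
  rw [inducedWt_degen_one, inducedWt_degen_two, inducedWt_degen_three] at this
  norm_num at this

end SahiPivotFamily

end Summit.CriticalPhenomena.PercolationContinuityZ3.Theorems
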